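import Summits.MatrixMultiplication.MatrixMultiplication.Theses.LevelGradedCohnUmans
import Literature.Barriers.MatrixMultiplication.NormalizerBarrier

/-!
# Negative lemmas for the crux `LevelOneGL2Designs` (stmt-MatrixMultiplication-14080), part P:
permutable subgroup designs never exceed the wall

Refuter-side (cdisprove) route-level negative lemma, valid for EVERY finite group `G` and EVERY
bi-invariant test space `J ≤ ℂ^G` (the `GradedDesignFamily` format of the route): if
`H₁, H₂, H₃ ≤ G` with `H₁H₂ = H₂H₁` (a permutable pair) admit ONE function `f₀ ∈ J` passing the
identity test (`f₀(1) = 1`, `f₀(abc) = 0` whenever `abc ≠ 1`) — which is what `J`-separation of the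
subgroup triple means after translating every target to `1` — then

* `card_tripleProducts_le_finrank`: the product set `H₁H₂H₃` is a `J`-interpolation set, so
  `|H₁H₂H₃| ≤ dim J` (translate `f₀` by `((ab)⁻¹, c⁻¹)`, which preserves `H₁H₂H₃` because `H₁H₂`
  is a group);
* `card_mul_card_mul_card_le_finrank_of_permutable`: with the subgroup TPP on top the triple
  product is injective, so `|H₁||H₂||H₃| ≤ dim J` — such designs never pass the wall `dim J = Σ_J d²`
  and are useless for every graded budget at exponent `≤ 3`.  (For three ARBITRARY subgroups TPP
  does not give injectivity: `S₃` with its three subgroups of order `2` has the TPP and `V = 8 > 6`.)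

At `(m,k) = (2,1)` this caps every Borel template with a split-torus or trivial middle
(`(U⁻,T,U⁺)`, `(Aff⁺,T,U⁻)`, `(U⁻⋊A₁, T', U⁺⋊A₃)`) at `N₁(p) ≈ p³`, a factor `p^{3/2}` below the
crux (cdisprove seat's `Disproof.lean`, `volume_le_of_permutable_subgroups`); it also constrains the
sibling crux `SubgroupIdentityDesigns` (stmt-14079): a template whose middle group permutes with an
outer one is dead at every level.  No positive Theses conclusion anywhere.
-/

namespace Summit.MatrixMultiplication.MatrixMultiplication.Theorems.LevelOneGL2Designs.Negative

open Literature.Barriers.MatrixMultiplication (SubgroupTPP)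

variable {G : Type} [Group G] [Fintype G] [DecidableEq G]

/-- **Permutable subgroup designs are interpolation sets.**  Let `J ≤ ℂ^G` be bi-invariant and let
`H₁, H₂, H₃ ≤ G` with `H₁H₂ = H₂H₁`.  If one `f₀ ∈ J` passes the identity test, then every delta
function on `S = H₁H₂H₃` is realised by `J`, so `|H₁H₂H₃| ≤ dim J`.  No TPP is needed. [folklore] -/
theorem card_tripleProducts_le_finrank (J : Submodule ℂ (G → ℂ))
    (hJ : ∀ f ∈ J, ∀ a b : G, (fun g => f (a * g * b)) ∈ J)
    (H₁ H₂ H₃ : Subgroup G)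
    (hperm : ∀ a ∈ H₁, ∀ b ∈ H₂, ∃ a' ∈ H₁, ∃ b' ∈ H₂, b * a = a' * b')
    (htest : ∃ f₀ ∈ J, f₀ 1 = 1 ∧
      ∀ a ∈ H₁, ∀ b ∈ H₂, ∀ c ∈ H₃, a * b * c ≠ 1 → f₀ (a * b * c) = 0) :
    Nat.card {g : G // ∃ a ∈ H₁, ∃ b ∈ H₂, ∃ c ∈ H₃, g = a * b * c} ≤ Module.finrank ℂ J := by
  classical
  obtain ⟨f₀, hf₀, h1, h0⟩ := htest
  set T := {g : G // ∃ a ∈ H₁, ∃ b ∈ H₂, ∃ c ∈ H₃, g = a * b * c} with hT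
  let r : J →ₗ[ℂ] (T → ℂ) :=
    { toFun := fun f t => (f : G → ℂ) t.1
      map_add' := fun f f' => by funext t; rfl
      map_smul' := fun a f => by funext t; rfl }
  have hsurj : Function.Surjective r := by
    rw [← LinearMap.range_eq_top, eq_top_iff, ← (Pi.basisFun ℂ T).span_eq, Submodule.span_le]
    rintro _ ⟨t₀, rfl⟩
    obtain ⟨a, ha, b, hb, c, hc, ht₀⟩ := t₀.2
    refine ⟨⟨fun g => f₀ ((a * b)⁻¹ * g * c⁻¹), hJ f₀ hf₀ _ _⟩, ?_⟩
    funext t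
    simp only [r, LinearMap.coe_mk, AddHom.coe_mk, Pi.basisFun_apply]
    obtain ⟨a', ha', b', hb', c', hc', ht⟩ := t.2
    obtain ⟨a'', ha'', b'', hb'', hp⟩ :=
      hperm (a⁻¹ * a') (H₁.mul_mem (H₁.inv_mem ha) ha') b⁻¹ (H₂.inv_mem hb)
    have he : (a * b)⁻¹ * t.1 * c⁻¹ = a'' * (b'' * b') * (c' * c⁻¹) := by
      rw [ht, show (a * b)⁻¹ * (a' * b' * c') * c⁻¹ = (b⁻¹ * (a⁻¹ * a')) * b' * c' * c⁻¹ by group,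
        hp]
      group
    by_cases heq : (a * b)⁻¹ * t.1 * c⁻¹ = 1
    · have htt : t = t₀ := by
        apply Subtype.ext
        rw [ht₀]
        calc t.1 = (a * b) * ((a * b)⁻¹ * t.1 * c⁻¹) * c := by group
          _ = a * b * c := by rw [heq]; group
      rw [heq, h1, htt, Pi.single_eq_same]
    · have hne : t ≠ t₀ := by
        rintro rfl
        apply heq
        rw [ht₀]; group
      rw [Pi.single_eq_of_ne hne, he]
      refine h0 _ ha'' _ (H₂.mul_mem hb'' hb') _ (H₃.mul_mem hc' (H₃.inv_mem hc)) ?_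
      rwa [← he]
  have h := LinearMap.finrank_le_finrank_of_surjective hsurj
  rwa [Module.finrank_fintype_fun_eq_card, ← Nat.card_eq_fintype_card] at h

/-- **Permutable subgroup designs never exceed the wall.**  With the subgroup TPP on top of the
hypotheses of `card_tripleProducts_le_finrank`, the product map `H₁ × H₂ × H₃ → H₁H₂H₃` is
injective (this needs the permutable pair), hence `|H₁||H₂||H₃| ≤ dim J`. [folklore] -/
theorem card_mul_card_mul_card_le_finrank_of_permutable (J : Submodule ℂ (G → ℂ))
    (hJ : ∀ f ∈ J, ∀ a b : G, (fun g => f (a * g * b)) ∈ J)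
    (H₁ H₂ H₃ : Subgroup G)
    (hperm : ∀ a ∈ H₁, ∀ b ∈ H₂, ∃ a' ∈ H₁, ∃ b' ∈ H₂, b * a = a' * b')
    (htpp : SubgroupTPP H₁ H₂ H₃)
    (htest : ∃ f₀ ∈ J, f₀ 1 = 1 ∧
      ∀ a ∈ H₁, ∀ b ∈ H₂, ∀ c ∈ H₃, a * b * c ≠ 1 → f₀ (a * b * c) = 0) :
    Nat.card H₁ * Nat.card H₂ * Nat.card H₃ ≤ Module.finrank ℂ J := by
  classical
  let T := {g : G // ∃ a ∈ H₁, ∃ b ∈ H₂, ∃ c ∈ H₃, g = a * b * c}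
  let φ : H₁ × H₂ × H₃ → T := fun x =>
    ⟨(x.1 : G) * x.2.1 * x.2.2, x.1, x.1.2, x.2.1, x.2.1.2, x.2.2, x.2.2.2, rfl⟩
  have hinj : Function.Injective φ := by
    rintro ⟨⟨a, ha⟩, ⟨b, hb⟩, ⟨c, hc⟩⟩ ⟨⟨a', ha'⟩, ⟨b', hb'⟩, ⟨c', hc'⟩⟩ he'
    have he : a * b * c = a' * b' * c' := congrArg Subtype.val he'
    obtain ⟨a₁, ha₁, b₁, hb₁, hp⟩ :=
      hperm (a'⁻¹ * a) (H₁.mul_mem (H₁.inv_mem ha') ha) b'⁻¹ (H₂.inv_mem hb')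
    have hrel : a₁ * (b₁ * b) * (c * c'⁻¹) = 1 := by
      calc a₁ * (b₁ * b) * (c * c'⁻¹) = (b'⁻¹ * (a'⁻¹ * a)) * b * c * c'⁻¹ := by rw [hp]; group
        _ = b'⁻¹ * a'⁻¹ * (a * b * c) * c'⁻¹ := by group
        _ = 1 := by rw [he]; group
    obtain ⟨-, -, h3⟩ := htpp a₁ ha₁ _ (H₂.mul_mem hb₁ hb) _ (H₃.mul_mem hc (H₃.inv_mem hc')) hrel
    have hcc : c = c' := mul_inv_eq_one.mp h3
    subst hcc
    have hab : a * b = a' * b' := mul_right_cancel he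
    have hrel2 : (a'⁻¹ * a) * (b * b'⁻¹) * (1 : G) = 1 := by
      calc (a'⁻¹ * a) * (b * b'⁻¹) * 1 = a'⁻¹ * (a * b) * b'⁻¹ := by group
        _ = 1 := by rw [hab]; group
    obtain ⟨k1, k2, -⟩ := htpp _ (H₁.mul_mem (H₁.inv_mem ha') ha) _
      (H₂.mul_mem hb (H₂.inv_mem hb')) 1 H₃.one_mem hrel2
    have haa : a = a' := by
      have := congrArg (a' * ·) k1; simpa using this
    have hbb : b = b' := mul_inv_eq_one.mp k2
    subst haa hbb
    rfl
  have hle := Nat.card_le_card_of_injective φ hinj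
  rw [Nat.card_prod, Nat.card_prod] at hle
  calc Nat.card H₁ * Nat.card H₂ * Nat.card H₃ = Nat.card H₁ * (Nat.card H₂ * Nat.card H₃) := by ring
    _ ≤ Nat.card T := hle
    _ ≤ Module.finrank ℂ J := card_tripleProducts_le_finrank J hJ H₁ H₂ H₃ hperm htest

/-- The same in the route's `GradedDesignFamily` format: a `J`-separated SUBGROUP triple (carriers
`X, Y, Z`) with a permutable pair `H₁H₂ = H₂H₁` has `|X|·|Y|·|Z| ≤ dim J`.  (Separation at the target
`(1,1)` supplies both the identity test and the subgroup TPP.) [folklore] -/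
theorem card_le_finrank_of_separated_permutable (J : Submodule ℂ (G → ℂ))
    (hJ : ∀ f ∈ J, ∀ a b : G, (fun g => f (a * g * b)) ∈ J)
    (H₁ H₂ H₃ : Subgroup G)
    (hperm : ∀ a ∈ H₁, ∀ b ∈ H₂, ∃ a' ∈ H₁, ∃ b' ∈ H₂, b * a = a' * b')
    {X Y Z : Finset G} (hX : ∀ g, g ∈ X ↔ g ∈ H₁) (hY : ∀ g, g ∈ Y ↔ g ∈ H₂)
    (hZ : ∀ g, g ∈ Z ↔ g ∈ H₃)
    (hsep : ∀ x₀ ∈ X, ∀ z₀ ∈ Z, ∃ f ∈ J, ∀ x ∈ X, ∀ y ∈ Y, ∀ y' ∈ Y, ∀ z ∈ Z,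
      (x = x₀ ∧ y = y' ∧ z = z₀ → f (x⁻¹ * y * y'⁻¹ * z) = 1) ∧
      (¬ (x = x₀ ∧ y = y' ∧ z = z₀) → f (x⁻¹ * y * y'⁻¹ * z) = 0)) :
    X.card * Y.card * Z.card ≤ Module.finrank ℂ J := by
  classical
  have h1X : (1 : G) ∈ X := (hX 1).mpr H₁.one_mem
  have h1Y : (1 : G) ∈ Y := (hY 1).mpr H₂.one_mem
  have h1Z : (1 : G) ∈ Z := (hZ 1).mpr H₃.one_mem
  obtain ⟨f, hf, hfsep⟩ := hsep 1 h1X 1 h1Z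
  have hval : ∀ a ∈ H₁, ∀ b ∈ H₂, ∀ c ∈ H₃,
      (a = 1 ∧ b = 1 ∧ c = 1 → f (a * b * c) = 1) ∧
        (¬ (a = 1 ∧ b = 1 ∧ c = 1) → f (a * b * c) = 0) := by
    intro a ha b hb c hc
    have h := hfsep a⁻¹ ((hX _).mpr (H₁.inv_mem ha)) b ((hY _).mpr hb) 1 h1Y c ((hZ _).mpr hc)
    simp only [inv_inv, inv_one, mul_one, inv_eq_one] at h
    exact h
  have htest : ∃ f₀ ∈ J, f₀ 1 = 1 ∧
      ∀ a ∈ H₁, ∀ b ∈ H₂, ∀ c ∈ H₃, a * b * c ≠ 1 → f₀ (a * b * c) = 0 := by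
    refine ⟨f, hf, ?_, fun a ha b hb c hc hne => ?_⟩
    · simpa using (hval 1 H₁.one_mem 1 H₂.one_mem 1 H₃.one_mem).1 ⟨rfl, rfl, rfl⟩
    · refine (hval a ha b hb c hc).2 fun h => hne ?_
      rw [h.1, h.2.1, h.2.2, one_mul, one_mul]
  have htpp : SubgroupTPP H₁ H₂ H₃ := by
    intro a ha b hb c hc habc
    by_contra hnot
    have h0 := (hval a ha b hb c hc).2 hnot
    have h1 := (hval 1 H₁.one_mem 1 H₂.one_mem 1 H₃.one_mem).1 ⟨rfl, rfl, rfl⟩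
    rw [habc] at h0
    simp only [one_mul] at h1
    rw [h1] at h0
    exact one_ne_zero h0
  have hmain := card_mul_card_mul_card_le_finrank_of_permutable J hJ H₁ H₂ H₃ hperm htpp htest
  have hcard : ∀ (H : Subgroup G) (S : Finset G), (∀ g, g ∈ S ↔ g ∈ H) → Nat.card H = S.card := by
    intro H S hS
    rw [Nat.card_congr (Equiv.subtypeEquivRight (fun g => (hS g).symm) : ↥H ≃ {g // g ∈ S}),
      Nat.card_eq_fintype_card, Fintype.card_coe]
  rwa [hcard H₁ X hX, hcard H₂ Y hY, hcard H₃ Z hZ] at hmain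

end Summit.MatrixMultiplication.MatrixMultiplication.Theorems.LevelOneGL2Designs.Negative
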